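import Summits.ABC.ABC.Theorems.TowerFourSubLiouville.Negative.Framing
import Summits.ABC.ABC.Theorems.IneffectiveSubspaceUniformSadicTowerFourFourthPowerDivisorRoth

/-!
# `TowerFourSubLiouville` (stmt-ABC-1649): the Liouville end `A = 2` holds with EVERY constant — `c = o(Π²)`

Negative-side calibration (standing disprover, cycle 7, refuter-cdisprove-stmt-ABC-1649-g7-0) of the TOP of the
exponent dial of the crux `∃ A < 2, ∀ ε > 0, ∃ C > 0, … c < C · Π^{A+ε}` (`Π = ∏ xᵢyᵢzᵢ`, `c = ∏ zᵢ^{i+1}`).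
Cycle 6 (`Negative.ConstantFree`, p127459) proved the elementary rung `R0`: `c < Π²` on every positive level-4
point, and crux ⟺ `s* := sup log c / log Π < 2`.  This file proves the next rung `R1` of the ladder recorded
in `Cruxes/TowerFourSubLiouville/Disproof.lean` § (6d), which was so far only prose:

* `towerIneq4_two_every_constant` — **for every `κ > 0` there is `c₁` (ineffective) such that every positive
  level-4 point with `c > c₁` has `c < κ · Π²`** — coprime or not.  Equivalently `c / Π² → 0` as `c → ∞`
  over ALL points of the level-4 tower: Liouville's exponent `2` is never attained up to a constant along an
  infinite family.

Mechanism (Thue–Siegel–Roth, form by form — exactly the reach of the tree's PROVED `roth_holds`): a point with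
`κΠ² ≤ c` and `a ≤ b` has `κ²·a·E ≤ 2` by the slack identity `Π⁴ = abc·E` (`Negative.Framing.bad_point_shape`
at `s = 2`), so `a`, `E`, hence `v = y₀y₁²y₂³ ≤ E³`, `w = z₀z₁²z₂³ ≤ E³` lie in the finite box `≤ ⌈2/κ²⌉³`,
and the point is a solution of `v·Y⁴ + a = w·Z⁴` with box-bounded `(v, w, a)`; the landed
`UniformSadicTowerFour.FourthPowerDivisor.binomialQuartic_bounded_box` (Roth per coefficient pair, maximum over
the box) bounds `Z`, hence `c = wZ⁴`.

READING FOR THE DISPROOF.  With `R0` and crux ⟺ `s* < 2`: the crux can fail only if `s* = 2` is a NON-attained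
supremum approached by points whose forms `(a, v, w)` escape every finite box — and now, quantitatively, with
`c/Π² → 0`: no enemy family of the crux can have `c ≥ κΠ²` infinitely often, for any `κ > 0`.  Every known
infinite family has `log c / log Π → 1`; the ladder above `R1` (`R2`: an effective saving `(log Π)^{−δ₀}`,
Baker-type; `R3`: every polylog; `R4` = the crux `Π^{2−δ}`) is where known mathematics stops (`R2`) and the
crux begins (`R4`).  For provers: `R1` is the most the per-form (Roth) stratum of the line
`fourth-radical-binomial-thue` yields for the crux's own inequality — uniformity in the form is the whole gap.

No `sorry`; axioms standard (Roth enters through the proved `Literature…roth_holds` behind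
`binomialQuartic_bounded_box`).  [cite: Roth1955]
-/

-- `Summit.ABC.ABC` is the mandated summit-side namespace (CONVENTIONS §2); the duplicate is deliberate.
set_option linter.dupNamespace false

namespace Summit.ABC.ABC.Theorems.TowerFourSubLiouville.Negative

open scoped BigOperators
open Summit.ABC.ABC.Theses.IneffectiveSubspace
open Summit.ABC.ABC.Theorems.UniformSadicTowerFour.FourthPowerDivisor (binomialQuartic_bounded_box)

/-- **Shape at the Liouville end.** A positive level-4 point with `κ·Π² ≤ c` and `a ≤ b` has
`κ² · a · E ≤ 2` (`E = (x₀y₀z₀)³(x₁y₁z₁)²(x₂y₂z₂)`): `bad_point_shape` at `s = 2`, i.e. `Π⁴ = abcE`,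
`κ²Π⁴ ≤ c² ≤ 2bc`. -/
theorem liouvilleEnd_shape {κ : ℝ} (hκ : 0 < κ) (x y z : Fin 4 → ℕ)
    (hpos : ∀ i, 0 < x i ∧ 0 < y i ∧ 0 < z i)
    (heq : (∏ i, x i ^ (i.val + 1)) + (∏ i, y i ^ (i.val + 1)) = ∏ i, z i ^ (i.val + 1))
    (hab : (∏ i, x i ^ (i.val + 1)) ≤ (∏ i, y i ^ (i.val + 1)))
    (hbad : κ * ((∏ i, x i * y i * z i : ℕ) : ℝ) ^ 2 ≤ ((∏ i, z i ^ (i.val + 1) : ℕ) : ℝ)) :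
    κ ^ 2 * ((∏ i, x i ^ (i.val + 1) : ℕ) : ℝ) *
      (((x 0 * y 0 * z 0) ^ 3 * (x 1 * y 1 * z 1) ^ 2 * (x 2 * y 2 * z 2) : ℕ) : ℝ) ≤ 2 := by
  have hbad' : κ * ((∏ i, x i * y i * z i : ℕ) : ℝ) ^ (2 : ℝ) ≤ ((∏ i, z i ^ (i.val + 1) : ℕ) : ℝ) := by
    rwa [Real.rpow_two]
  have hshape := bad_point_shape hκ (by norm_num : (0 : ℝ) < 2) x y z hpos heq hbad'
  rw [min_eq_left hab, show (4 : ℝ) / 2 = 2 by norm_num, Real.rpow_two, div_pow] at hshape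
  have hc0 : (0 : ℝ) < ((∏ i, z i ^ (i.val + 1) : ℕ) : ℝ) := by
    exact_mod_cast Finset.prod_pos fun i _ => pow_pos (hpos i).2.2 _
  have hκ2 : (0 : ℝ) < κ ^ 2 := by positivity
  -- `a E c² ≤ 2 c² / κ²`  ⟹  `κ² a E ≤ 2`
  have h1 : ((∏ i, x i ^ (i.val + 1) : ℕ) : ℝ) *
      (((x 0 * y 0 * z 0) ^ 3 * (x 1 * y 1 * z 1) ^ 2 * (x 2 * y 2 * z 2) : ℕ) : ℝ) ≤ 2 / κ ^ 2 := by
    have h := hshape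
    rw [show (2 : ℝ) * (((∏ i, z i ^ (i.val + 1) : ℕ) : ℝ) ^ 2 / κ ^ 2) =
      (2 / κ ^ 2) * ((∏ i, z i ^ (i.val + 1) : ℕ) : ℝ) ^ 2 by ring] at h
    exact le_of_mul_le_mul_right h (by positivity)
  rw [le_div_iff₀ hκ2] at h1
  linarith

/-- **A violator of `c < κΠ²` with `a ≤ b` has box-bounded `c`.** If `2/κ² ≤ B` and `N` bounds `t₂` for the
solutions of `m₁t₁⁴ + g = m₂t₂⁴` in the box `m₁, m₂, g ≤ B³`, `g ≥ 1` (`binomialQuartic_bounded_box (B^3)`),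
then every positive level-4 point with `a ≤ b` and `κΠ² ≤ c` has `c ≤ B³·N⁴`. -/
theorem liouvilleEnd_violator_le {κ : ℝ} (hκ : 0 < κ) {B N : ℕ} (hB : 2 / κ ^ 2 ≤ (B : ℝ))
    (hN : ∀ m₁ m₂ g t₁ t₂ : ℕ, m₁ ≤ B ^ 3 → m₂ ≤ B ^ 3 → 0 < g → g ≤ B ^ 3 →
      m₁ * t₁ ^ 4 + g = m₂ * t₂ ^ 4 → t₂ ≤ N)
    (x y z : Fin 4 → ℕ) (hpos : ∀ i, 0 < x i ∧ 0 < y i ∧ 0 < z i)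
    (heq : (∏ i, x i ^ (i.val + 1)) + (∏ i, y i ^ (i.val + 1)) = ∏ i, z i ^ (i.val + 1))
    (hab : (∏ i, x i ^ (i.val + 1)) ≤ (∏ i, y i ^ (i.val + 1)))
    (hbad : κ * ((∏ i, x i * y i * z i : ℕ) : ℝ) ^ 2 ≤ ((∏ i, z i ^ (i.val + 1) : ℕ) : ℝ)) :
    (∏ i, z i ^ (i.val + 1)) ≤ B ^ 3 * N ^ 4 := by
  have hshape := liouvilleEnd_shape hκ x y z hpos heq hab hbad
  -- names
  generalize ha : (∏ i, x i ^ (i.val + 1)) = a at heq hab hshape ⊢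
  have hb' : (∏ i, y i ^ (i.val + 1)) = (y 0 * y 1 ^ 2 * y 2 ^ 3) * y 3 ^ 4 := by
    simp only [Fin.prod_univ_four, Fin.isValue, Fin.val_zero, Fin.val_one, Fin.val_two]
    simp only [show (3 : Fin 4).val = 3 from rfl]
    ring
  have hc' : (∏ i, z i ^ (i.val + 1)) = (z 0 * z 1 ^ 2 * z 2 ^ 3) * z 3 ^ 4 := by
    simp only [Fin.prod_univ_four, Fin.isValue, Fin.val_zero, Fin.val_one, Fin.val_two]
    simp only [show (3 : Fin 4).val = 3 from rfl]
    ring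
  rw [hb'] at heq hab
  rw [hc'] at heq ⊢
  generalize hE : (x 0 * y 0 * z 0) ^ 3 * (x 1 * y 1 * z 1) ^ 2 * (x 2 * y 2 * z 2) = E at hshape
  obtain ⟨hx0, hy0, hz0⟩ := hpos 0
  obtain ⟨hx1, hy1, hz1⟩ := hpos 1
  obtain ⟨hx2, hy2, hz2⟩ := hpos 2
  have ha0 : 0 < a := by rw [← ha]; exact Finset.prod_pos fun i _ => pow_pos (hpos i).1 _
  have hE0 : 0 < E := by rw [← hE]; positivity
  have hκ2 : (0 : ℝ) < κ ^ 2 := by positivity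
  -- `a ≤ B` and `E ≤ B`
  have ha1 : (1 : ℝ) ≤ a := by exact_mod_cast ha0
  have hE1 : (1 : ℝ) ≤ E := by exact_mod_cast hE0
  have haE : κ ^ 2 * ((a : ℝ) * E) ≤ 2 := by rw [← mul_assoc]; exact hshape
  have haR : (a : ℝ) ≤ B := by
    have h1 : κ ^ 2 * (a : ℝ) ≤ 2 :=
      le_trans (mul_le_mul_of_nonneg_left (le_mul_of_one_le_right (by positivity) hE1) hκ2.le) haE
    have h2 : (a : ℝ) ≤ 2 / κ ^ 2 := by rw [le_div_iff₀ hκ2]; linarith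
    exact h2.trans hB
  have hER : (E : ℝ) ≤ B := by
    have h1 : κ ^ 2 * (E : ℝ) ≤ 2 :=
      le_trans (mul_le_mul_of_nonneg_left (le_mul_of_one_le_left (by positivity) ha1) hκ2.le) haE
    have h2 : (E : ℝ) ≤ 2 / κ ^ 2 := by rw [le_div_iff₀ hκ2]; linarith
    exact h2.trans hB
  have haB : a ≤ B := by exact_mod_cast haR
  have hEB : E ≤ B := by exact_mod_cast hER
  have hB1 : 1 ≤ B := le_trans ha0 haB
  -- the coefficients of the binomial quartic lie in the box `B³`
  have hvE : y 0 * y 1 ^ 2 * y 2 ^ 3 ≤ E ^ 3 := by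
    rw [← hE]
    exact Nat.le_of_dvd (pow_pos (by positivity) 3)
      ⟨x 0 ^ 9 * z 0 ^ 9 * y 0 ^ 8 * (x 1 ^ 6 * z 1 ^ 6 * y 1 ^ 4) * (x 2 ^ 3 * z 2 ^ 3), by ring⟩
  have hwE : z 0 * z 1 ^ 2 * z 2 ^ 3 ≤ E ^ 3 := by
    rw [← hE]
    exact Nat.le_of_dvd (pow_pos (by positivity) 3)
      ⟨x 0 ^ 9 * y 0 ^ 9 * z 0 ^ 8 * (x 1 ^ 6 * y 1 ^ 6 * z 1 ^ 4) * (x 2 ^ 3 * y 2 ^ 3), by ring⟩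
  have hE3 : E ^ 3 ≤ B ^ 3 := Nat.pow_le_pow_left hEB 3
  have haB3 : a ≤ B ^ 3 := le_trans haB (by
    calc B = B ^ 1 := (pow_one B).symm
      _ ≤ B ^ 3 := Nat.pow_le_pow_right hB1 (by norm_num))
  have hZ : z 3 ≤ N :=
    hN (y 0 * y 1 ^ 2 * y 2 ^ 3) (z 0 * z 1 ^ 2 * z 2 ^ 3) a (y 3) (z 3) (hvE.trans hE3) (hwE.trans hE3)
      ha0 haB3 (by rw [← heq]; ring)
  calc z 0 * z 1 ^ 2 * z 2 ^ 3 * z 3 ^ 4 ≤ B ^ 3 * N ^ 4 :=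
    Nat.mul_le_mul (hwE.trans hE3) (Nat.pow_le_pow_left hZ 4)

/-- **`R1`: the Liouville end holds with every constant (`c = o(Π²)`).** For every `κ > 0` there is `c₁`
(ineffective: Roth) such that every positive level-4 tower point `a + b = c` — coprime or not — with `c > c₁`
satisfies `c < κ · Π²`.  Since every point already has `c < Π²` (`Negative.ConstantFree`, `R0`) and the crux
is `∃ δ > 0, c < Π^{2−δ}` (`R4`), this is the first rung strictly between the trivial bound and the crux that
the tree proves; the effective polylog rung `R2` (Baker) and "every polylog" `R3` are not in the tree.
[cite: Roth1955] -/
theorem towerIneq4_two_every_constant (κ : ℝ) (hκ : 0 < κ) :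
    ∃ c₁ : ℕ, ∀ x y z : Fin 4 → ℕ, (∀ i, 0 < x i ∧ 0 < y i ∧ 0 < z i) →
      (∏ i, x i ^ (i.val + 1)) + (∏ i, y i ^ (i.val + 1)) = ∏ i, z i ^ (i.val + 1) →
      c₁ < ∏ i, z i ^ (i.val + 1) →
      ((∏ i, z i ^ (i.val + 1) : ℕ) : ℝ) < κ * ((∏ i, x i * y i * z i : ℕ) : ℝ) ^ 2 := by
  obtain ⟨N, hN⟩ := binomialQuartic_bounded_box (⌈2 / κ ^ 2⌉₊ ^ 3)
  have hB : 2 / κ ^ 2 ≤ ((⌈2 / κ ^ 2⌉₊ : ℕ) : ℝ) := Nat.le_ceil _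
  refine ⟨⌈2 / κ ^ 2⌉₊ ^ 3 * N ^ 4, fun x y z hpos heq hc => ?_⟩
  by_contra hnot
  rw [not_lt] at hnot
  rcases le_total (∏ i, x i ^ (i.val + 1)) (∏ i, y i ^ (i.val + 1)) with hab | hba
  · have := liouvilleEnd_violator_le hκ hB hN x y z hpos heq hab hnot
    omega
  · have hP : (∏ i, y i * x i * z i) = ∏ i, x i * y i * z i :=
      Finset.prod_congr rfl fun i _ => by ring
    have := liouvilleEnd_violator_le hκ hB hN y x z
      (fun i => ⟨(hpos i).2.1, (hpos i).1, (hpos i).2.2⟩) (by rw [add_comm]; exact heq) hba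
      (by rw [hP]; exact hnot)
    omega

/-- The same, read as an ENEMY CEILING: there is no `κ > 0` and no infinite set of positive level-4 points
(unbounded `c`) along which `κ · Π² ≤ c`.  (Contrapositive packaging of `towerIneq4_two_every_constant`.) -/
theorem no_enemy_at_liouville_end :
    ¬ ∃ κ : ℝ, 0 < κ ∧ ∀ c₁ : ℕ, ∃ x y z : Fin 4 → ℕ, (∀ i, 0 < x i ∧ 0 < y i ∧ 0 < z i) ∧
      (∏ i, x i ^ (i.val + 1)) + (∏ i, y i ^ (i.val + 1)) = ∏ i, z i ^ (i.val + 1) ∧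
      c₁ < ∏ i, z i ^ (i.val + 1) ∧
      κ * ((∏ i, x i * y i * z i : ℕ) : ℝ) ^ 2 ≤ ((∏ i, z i ^ (i.val + 1) : ℕ) : ℝ) := by
  rintro ⟨κ, hκ, h⟩
  obtain ⟨c₁, hc₁⟩ := towerIneq4_two_every_constant κ hκ
  obtain ⟨x, y, z, hpos, heq, hc, hbad⟩ := h c₁
  have := hc₁ x y z hpos heq hc
  linarith

end Summit.ABC.ABC.Theorems.TowerFourSubLiouville.Negative
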